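import Summits.AtomisticToContinuum.Crystallization.Theorems.ExcessDecayLiouvillePhononStabilityCertBlochDefs

/-!
# Near-certificate layer B2-a: the Bloch symbol at rational phases as a rational quadratic form (lead c3, v10)

Support file for crux `PhononStability` (stmt-AtomisticToContinuum-9333), line `contragredient-window-collapse`;
helper of `…CertBlochPoint` (the exact symbol check at a rational torus point, stub `stub_certBlochPoint`).

Phases with rational phase monomials `zⁿ = toC (phaseQ P n)` (this holds at the rational torus point `toZ P`,
`…CertBlochPoint.phase_toZ`; `phaseQ` computes in `ℚ × ℚ`, negative powers through the conjugate) make the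
symbol form `symbolForm L z a` an explicit rational quadratic form in the twelve real coordinates `rc a` of the
sublattice amplitudes `a : Fin 2 → ℂ³` (`symbolForm_eq_listMat`): an entry `((m, m', n), M)` contributes
`M̃ᵢⱼ · C_{kl}` on the coordinate pair `(i,k), (j,l)` with `M̃ = (M + Mᵀ)/2` and `C` the `4 × 4` Gram table of the
coefficient vectors of the two linear forms `Re vᵢ`, `Im vᵢ` (`v = zⁿ a_{m'} − a_m`).  `pre` evaluates these data
once per entry into a first-order record (nested tuples; no closures over unevaluated sums) and `symMatF` reads
the `12 × 12` matrix off the records (`symMatF_pre`). [folklore]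
-/

noncomputable section

open scoped BigOperators Classical ComplexConjugate

namespace Summit.AtomisticToContinuum.Crystallization.Theorems.PhononStabilityCWC.Cert

/-! ## Rational complex arithmetic on the unit circle -/

/-- A rational point of the plane read as a complex number. -/
def toC (x : ℚ × ℚ) : ℂ := ⟨(x.1 : ℝ), (x.2 : ℝ)⟩

/-- Complex multiplication on rational pairs. -/
def cmulQ (x y : ℚ × ℚ) : ℚ × ℚ := (x.1 * y.1 - x.2 * y.2, x.1 * y.2 + x.2 * y.1)

/-- Complex conjugation on rational pairs. -/
def cconjQ (x : ℚ × ℚ) : ℚ × ℚ := (x.1, -x.2)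

/-- Natural powers on rational pairs. -/
def cpowN (x : ℚ × ℚ) : ℕ → ℚ × ℚ
  | 0 => (1, 0)
  | k + 1 => cmulQ (cpowN x k) x

/-- Integer powers of a rational pair ON THE UNIT CIRCLE: a negative power is a power of the conjugate. -/
def cpowZ (x : ℚ × ℚ) : ℤ → ℚ × ℚ
  | Int.ofNat k => cpowN x k
  | Int.negSucc k => cpowN (cconjQ x) (k + 1)

/-- The phase monomial `∏ᵢ (P i)^(nᵢ)` of three rational circle points, computed in `ℚ × ℚ`. -/
def phaseQ (P : Fin 3 → ℚ × ℚ) (n : Fin 3 → ℤ) : ℚ × ℚ :=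
  cmulQ (cmulQ (cpowZ (P 0) (n 0)) (cpowZ (P 1) (n 1))) (cpowZ (P 2) (n 2))

/-- `toC` is multiplicative. [folklore] -/
theorem toC_cmulQ (x y : ℚ × ℚ) : toC (cmulQ x y) = toC x * toC y := by
  apply Complex.ext <;> simp [toC, cmulQ]

/-- `toC` commutes with conjugation. [folklore] -/
theorem toC_cconjQ (x : ℚ × ℚ) : toC (cconjQ x) = conj (toC x) := by
  apply Complex.ext <;> simp [toC, cconjQ]

/-- `toC` commutes with natural powers. [folklore] -/
theorem toC_cpowN (x : ℚ × ℚ) (k : ℕ) : toC (cpowN x k) = toC x ^ k := by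
  induction k with
  | zero => apply Complex.ext <;> simp [cpowN, toC]
  | succ k ih => rw [cpowN, toC_cmulQ, ih, pow_succ]

/-- On the unit circle `toC` commutes with integer powers. [folklore] -/
theorem toC_cpowZ {x : ℚ × ℚ} (hx : Complex.normSq (toC x) = 1) (n : ℤ) : toC (cpowZ x n) = toC x ^ n := by
  cases n with
  | ofNat k => simp only [cpowZ, toC_cpowN, Int.ofNat_eq_natCast, zpow_natCast]
  | negSucc k =>
      simp only [cpowZ, toC_cpowN, toC_cconjQ, zpow_negSucc]
      rw [← inv_pow, Complex.inv_def, hx]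
      simp

/-! ## The twelve real coordinates and the linear forms `Re vᵢ`, `Im vᵢ` -/

/-- Index of the twelve real coordinates: `(i, m, b)` = component `i`, sublattice `m`, `b = 0` real part /
`b = 1` imaginary part. -/
abbrev K12 := Fin 3 × Fin 2 × Fin 2

/-- The real coordinates of the amplitudes. -/
def rc (a : Fin 2 → Fin 3 → ℂ) (I : K12) : ℝ := if I.2.2 = 0 then (a I.2.1 I.1).re else (a I.2.1 I.1).im

/-- Coefficient of the coordinate `(i, k)` in `Re vᵢ` (`v = φ a_{m'} − a_m`, `c = (m, m', n)`, `φ = (p, q)`):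
`Re vᵢ = p·Re a_{m'} i − q·Im a_{m'} i − Re a_m i`. -/
def cRe (φ : ℚ × ℚ) (c : BondClass) (k : Fin 2 × Fin 2) : ℚ :=
  (if k = (c.2.1, 0) then φ.1 else 0) + (if k = (c.2.1, 1) then -φ.2 else 0) + (if k = (c.1, 0) then -1 else 0)

/-- Coefficient of the coordinate `(i, k)` in `Im vᵢ`: `Im vᵢ = q·Re a_{m'} i + p·Im a_{m'} i − Im a_m i`. -/
def cIm (φ : ℚ × ℚ) (c : BondClass) (k : Fin 2 × Fin 2) : ℚ :=
  (if k = (c.2.1, 0) then φ.2 else 0) + (if k = (c.2.1, 1) then φ.1 else 0) + (if k = (c.1, 1) then -1 else 0)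

/-- `Re vᵢ` as a linear form in the coordinates. [folklore] -/
theorem re_blochDiff (φ : ℚ × ℚ) (c : BondClass) (a : Fin 2 → Fin 3 → ℂ) (i : Fin 3) :
    (toC φ * a c.2.1 i - a c.1 i).re = ∑ k : Fin 2 × Fin 2, (cRe φ c k : ℝ) * rc a (i, k) := by
  have hc : ∀ k, (cRe φ c k : ℝ) = (if k = (c.2.1, 0) then (φ.1 : ℝ) else 0) +
      (if k = (c.2.1, 1) then -(φ.2 : ℝ) else 0) + (if k = (c.1, 0) then -1 else 0) := by
    intro k; unfold cRe; split_ifs <;> push_cast <;> ring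
  simp only [hc, add_mul, ite_mul, zero_mul, Finset.sum_add_distrib, Finset.sum_ite_eq', Finset.mem_univ,
    if_true]
  simp [rc, toC, Complex.mul_re]
  ring

/-- `Im vᵢ` as a linear form in the coordinates. [folklore] -/
theorem im_blochDiff (φ : ℚ × ℚ) (c : BondClass) (a : Fin 2 → Fin 3 → ℂ) (i : Fin 3) :
    (toC φ * a c.2.1 i - a c.1 i).im = ∑ k : Fin 2 × Fin 2, (cIm φ c k : ℝ) * rc a (i, k) := by
  have hc : ∀ k, (cIm φ c k : ℝ) = (if k = (c.2.1, 0) then (φ.2 : ℝ) else 0) +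
      (if k = (c.2.1, 1) then (φ.1 : ℝ) else 0) + (if k = (c.1, 1) then -1 else 0) := by
    intro k; unfold cIm; split_ifs <;> push_cast <;> ring
  simp only [hc, add_mul, ite_mul, zero_mul, Finset.sum_add_distrib, Finset.sum_ite_eq', Finset.mem_univ,
    if_true]
  simp [rc, toC, Complex.mul_im]
  ring

/-! ## The symbol entry as a real quadratic form -/

/-- Real part of the sesquilinear form of a rational matrix, symmetrised. [folklore] -/
theorem re_cbil_symm (M : Mat) (v : Fin 3 → ℂ) :
    (cbil M v v).re = ∑ i, ∑ j, (((M i j + M j i) / 2 : ℚ) : ℝ) * ((v i).re * (v j).re + (v i).im * (v j).im) := by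
  have h0 : (cbil M v v).re = ∑ i, ∑ j, (M i j : ℝ) * ((v i).re * (v j).re + (v i).im * (v j).im) := by
    unfold cbil
    rw [Complex.re_sum]
    refine Finset.sum_congr rfl fun i _ => ?_
    rw [Complex.re_sum]
    refine Finset.sum_congr rfl fun j _ => ?_
    simp [Complex.mul_re, Complex.mul_im]
    ring
  have hsw : (∑ i, ∑ j, (M j i : ℝ) * ((v i).re * (v j).re + (v i).im * (v j).im))
      = ∑ i, ∑ j, (M i j : ℝ) * ((v i).re * (v j).re + (v i).im * (v j).im) := by
    rw [Finset.sum_comm]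
    exact Finset.sum_congr rfl fun i _ => Finset.sum_congr rfl fun j _ => by ring
  have h2 : (∑ i, ∑ j, (((M i j + M j i) / 2 : ℚ) : ℝ) * ((v i).re * (v j).re + (v i).im * (v j).im))
      = ((∑ i, ∑ j, (M i j : ℝ) * ((v i).re * (v j).re + (v i).im * (v j).im))
        + ∑ i, ∑ j, (M j i : ℝ) * ((v i).re * (v j).re + (v i).im * (v j).im)) / 2 := by
    rw [← Finset.sum_add_distrib, Finset.sum_div]
    refine Finset.sum_congr rfl fun i _ => ?_
    rw [← Finset.sum_add_distrib, Finset.sum_div]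
    refine Finset.sum_congr rfl fun j _ => ?_
    push_cast; ring
  rw [h2, hsw, h0]; ring

/-- Expansion of a bilinear combination of two families of linear forms. [folklore] -/
theorem bilin_expand {ι κ : Type*} [Fintype ι] [Fintype κ] (m : ι → ι → ℝ) (X Y : ι → κ → ℝ) :
    (∑ i, ∑ j, m i j * ((∑ k, X i k) * (∑ l, X j l) + (∑ k, Y i k) * (∑ l, Y j l)))
      = ∑ i, ∑ k, ∑ j, ∑ l, m i j * (X i k * X j l + Y i k * Y j l) := by
  have h : ∀ i j, m i j * ((∑ k, X i k) * (∑ l, X j l) + (∑ k, Y i k) * (∑ l, Y j l))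
      = ∑ k, ∑ l, m i j * (X i k * X j l + Y i k * Y j l) := by
    intro i j
    rw [Finset.sum_mul_sum, Finset.sum_mul_sum, ← Finset.sum_add_distrib, Finset.mul_sum]
    refine Finset.sum_congr rfl fun k _ => ?_
    rw [← Finset.sum_add_distrib, Finset.mul_sum]
  simp_rw [h]
  exact Finset.sum_congr rfl fun i _ => Finset.sum_comm

/-- The (clean) `12 × 12` rational matrix of one list entry at the rational torus point `P`. -/
def entryMat (P : Fin 3 → ℚ × ℚ) (e : BondClass × Mat) (I J : K12) : ℚ :=
  (e.2 I.1 J.1 + e.2 J.1 I.1) / 2 *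
    (cRe (phaseQ P e.1.2.2) e.1 I.2 * cRe (phaseQ P e.1.2.2) e.1 J.2 +
      cIm (phaseQ P e.1.2.2) e.1 I.2 * cIm (phaseQ P e.1.2.2) e.1 J.2)

/-- **One symbol entry is the quadratic form of `entryMat` in the real coordinates.** [folklore] -/
theorem entry_form {P : Fin 3 → ℚ × ℚ} {z : Fin 3 → ℂ} (hz : ∀ n, phase z n = toC (phaseQ P n))
    (e : BondClass × Mat) (a : Fin 2 → Fin 3 → ℂ) :
    (cbil e.2 (blochDiff e.1 z a) (blochDiff e.1 z a)).re
      = ∑ I : K12, ∑ J : K12, (entryMat P e I J : ℝ) * rc a I * rc a J := by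
  have hv : ∀ i, blochDiff e.1 z a i = toC (phaseQ P e.1.2.2) * a e.1.2.1 i - a e.1.1 i := by
    intro i; simp only [blochDiff, hz]
  rw [re_cbil_symm]
  simp only [hv, re_blochDiff, im_blochDiff]
  rw [bilin_expand]
  simp only [Fintype.sum_prod_type]
  refine Finset.sum_congr rfl fun i _ => Finset.sum_congr rfl fun m _ => Finset.sum_congr rfl fun b _ => ?_
  refine Finset.sum_congr rfl fun j _ => Finset.sum_congr rfl fun m' _ => Finset.sum_congr rfl fun b' _ => ?_
  simp only [entryMat]
  push_cast
  ring

/-- The (clean) `12 × 12` rational matrix of a list at the rational torus point `P`. -/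
def listMat (L : List (BondClass × Mat)) (P : Fin 3 → ℚ × ℚ) (I J : K12) : ℚ := (L.map fun e => entryMat P e I J).sum

/-- **The symbol form at phases with rational phase monomials (a rational torus point) is the quadratic form
of `listMat` in the real coordinates.** [folklore] -/
theorem symbolForm_eq_listMat {P : Fin 3 → ℚ × ℚ} {z : Fin 3 → ℂ} (hz : ∀ n, phase z n = toC (phaseQ P n))
    (L : List (BondClass × Mat)) (a : Fin 2 → Fin 3 → ℂ) :
    symbolForm L z a = ∑ I : K12, ∑ J : K12, (listMat L P I J : ℝ) * rc a I * rc a J := by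
  induction L with
  | nil => simp [symbolForm, listMat]
  | cons e L ih =>
      have h1 : symbolForm (e :: L) z a
          = (cbil e.2 (blochDiff e.1 z a) (blochDiff e.1 z a)).re + symbolForm L z a := by
        simp [symbolForm]
      have h2 : ∀ I J, listMat (e :: L) P I J = entryMat P e I J + listMat L P I J := by
        intro I J; simp [listMat]
      rw [h1, ih, entry_form hz]
      simp only [h2, Rat.cast_add, add_mul, Finset.sum_add_distrib]

/-! ## Materialised per-entry data (evaluated once per entry, read in `O(1)`) -/

/-- read a triple -/
def sel3 {α : Type*} (t : α × α × α) (i : Fin 3) : α :=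
  match i with
  | 0 => t.1
  | 1 => t.2.1
  | 2 => t.2.2

/-- tabulate a function on `Fin 3` as a triple (evaluates now) -/
def tab3 {α : Type*} (f : Fin 3 → α) : α × α × α := (f 0, f 1, f 2)

/-- round trip. [folklore] -/
theorem sel3_tab3 {α : Type*} (f : Fin 3 → α) (i : Fin 3) : sel3 (tab3 f) i = f i := by
  fin_cases i <;> rfl

/-- read a quadruple indexed by `Fin 2 × Fin 2` -/
def sel4 {α : Type*} (t : α × α × α × α) (k : Fin 2 × Fin 2) : α :=
  match k with
  | (0, 0) => t.1
  | (0, 1) => t.2.1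
  | (1, 0) => t.2.2.1
  | (1, 1) => t.2.2.2

/-- tabulate a function on `Fin 2 × Fin 2` as a quadruple (evaluates now) -/
def tab4 {α : Type*} (f : Fin 2 × Fin 2 → α) : α × α × α × α := (f (0, 0), f (0, 1), f (1, 0), f (1, 1))

/-- round trip. [folklore] -/
theorem sel4_tab4 {α : Type*} (f : Fin 2 × Fin 2 → α) (k : Fin 2 × Fin 2) : sel4 (tab4 f) k = f k := by
  rcases k with ⟨m, b⟩
  fin_cases m <;> fin_cases b <;> rfl

/-- per-entry data: the symmetrised matrix `M̃` (a `3 × 3` table) and the coefficient Gram table `C` (`4 × 4`) -/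
abbrev EDat := ((ℚ × ℚ × ℚ) × (ℚ × ℚ × ℚ) × (ℚ × ℚ × ℚ)) ×
  ((ℚ × ℚ × ℚ × ℚ) × (ℚ × ℚ × ℚ × ℚ) × (ℚ × ℚ × ℚ × ℚ) × (ℚ × ℚ × ℚ × ℚ))

/-- precompute the data of one entry at the rational torus point `P` (one phase, 8 coefficients, 25 products) -/
def pre (P : Fin 3 → ℚ × ℚ) (e : BondClass × Mat) : EDat :=
  let φ := phaseQ P e.1.2.2
  let r := tab4 (cRe φ e.1)
  let s := tab4 (cIm φ e.1)
  (tab3 fun i => tab3 fun j => (e.2 i j + e.2 j i) / 2,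
    tab4 fun k => tab4 fun l => sel4 r k * sel4 r l + sel4 s k * sel4 s l)

/-- the `12 × 12` rational matrix read off the precomputed data -/
def symMatF (T : List EDat) (I J : K12) : ℚ := (T.map fun t => sel3 (sel3 t.1 I.1) J.1 * sel4 (sel4 t.2 I.2) J.2).sum

/-- the fast matrix is the clean matrix. [folklore] -/
theorem symMatF_pre (L : List (BondClass × Mat)) (P : Fin 3 → ℚ × ℚ) (I J : K12) :
    symMatF (L.map (pre P)) I J = listMat L P I J := by
  unfold symMatF listMat
  rw [List.map_map]
  congr 1
  refine List.map_congr_left fun e _ => ?_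
  simp only [Function.comp_apply, pre, sel3_tab3, sel4_tab4, entryMat]

end Summit.AtomisticToContinuum.Crystallization.Theorems.PhononStabilityCWC.Cert

end
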